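import Mathlib
import Summits.ValiantsHypothesis.ValiantsHypothesis.Theorems.FifoMatchingNFPolytopeQueueGridFaceDefs
import Literature.Barriers.PneNP.TSPExtensionComplexityFaces
import Literature.Computability.AlgebraicComplexity.NestFreeMatchingPoly
import HarnessLib

/-!
# K1 `Theses.FifoMatching.NFPolytopeQuasiPolyXC` ⇐ input (A) (queue-grid face) ∧ input (B) (pattern polytope is xc-hard)

Theorems-side port (c1 g5, assembly hand per director-valiant R150 (ii)) of val-idea-7 g6's kernel-checked assembly
`nfp_xc_of_queueGrid` of the line workfile `Cruxes/NNLinearDegreeCofactorHard/Lines/queue_grid_face.lean`, stated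
as the BODY of the route decl `Summit.ValiantsHypothesis.ValiantsHypothesis.Theses.FifoMatching.NFPolytopeQuasiPolyXC`
(stmt-ValiantsHypothesis-26254, K1; the decl inlines `newt`/`nestFreeMatchingPoly` verbatim, so the closer is one `exact`
in a file importing the route — kept out of this file only because the farm node serving this seat still has a pre-rev-9
`Theses.FifoMatching` olean, R147 (b)) with the two inputs as hypotheses written out in full over the Theorems-side
copies `QueueGridFace.newt / queueGridPP` (`Theorems/FifoMatchingNFPolytopeQueueGridFaceDefs.lean`):

* (A) = the body of the line's `QueueGridFaceProjection` (in flight: qg1 g0 rigidity + c1 g5 assembly via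
  `QueueGridFace.face_projection_of_gadget_prop`, p612281);
* (B) = the body of the line's `QueueGridPPHard` (= `QueueGridFace.queueGridPPHard_of_corGridMinorBound` of
  `Theorems/FifoMatchingNFPolytopeQueueGridCorProjection.lean` applied to the AFHMS 2019 print fact, val-lit p9).

So once (A) is a theorem, K1 holds CONDITIONALLY on the one print fact, by `newtXC_of_inputs hA (… fact)`.
Honesty: this file proves an implication only; K1 stays OPEN until (A) lands and is then conditional on the Literature
fact; HD-1 (stmt-26253), `NNDivisionHard` (stmt-21181) untouched; stmt-23918 / 24468 CLOSED, untouched; VP ≠ VNP is not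
moved (monotone / polyhedral world, FRONTIER currency).

Proof (val-idea-7 g6, unchanged): for `n` large take `r = ⌊√n⌋/2 − 1`, so `(r+1)(2r+1) ≤ n`; an EF of `NFP(2n)` of size
`t` restricts to the face (`HasEFOfSize.inter_eqs`, size `t`) and projects to `PP_r` (`HasEFOfSize.image_comp`, size
`4n² + t`); the grid bound at `c' = 2c + 4` beats `2^{(log₂ n + c)^c} + 4n²` because `log₂ n ≤ 2 log₂ r + 5`.  The route
decl inlines `nestFreeMatchingPoly n ℝ≥0` (`rfl`, `nestFreeMatchingPoly_eq_sum_ite`) and `newt` verbatim.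
-/

-- Sub = Summit single-conjunct layout: the duplicated namespace component is mandated by the tree.
set_option linter.dupNamespace false

namespace Summit.ValiantsHypothesis.ValiantsHypothesis.Theorems.FifoMatching.QueueGridFace

open Matrix MvPolynomial Literature.Computability.AlgebraicComplexity Literature.Barriers.PneNP
open scoped NNReal

/-- Newton polytopes live in the nonnegative orthant (exponents are naturals). [folklore] -/
theorem newt_nonneg {σ : Type} (f : MvPolynomial σ ℝ≥0) (x : σ → ℝ) (hx : x ∈ newt f) (i : σ) : 0 ≤ x i := by
  have hsub : suppPts f ⊆ Set.univ.pi (fun _ : σ => Set.Ici (0 : ℝ)) := by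
    rintro _ ⟨d, -, rfl⟩
    simp only [Set.mem_univ_pi, Set.mem_Ici]
    intro j
    exact Nat.cast_nonneg _
  have hx' := convexHull_min hsub (convex_pi fun _ _ => convex_Ici (0 : ℝ)) hx
  exact Set.mem_univ_pi.mp hx' i

/-- arithmetic: the quasi-polynomial thresholds in `n` sit below those in the grid side `r ≈ √(n/2)`, with room for
the additive `4n²` of the slack-form projection. -/
theorem grid_threshold_room (lam c ℓ : ℕ) (hℓ : ℓ ≤ 2 * lam + 5) :
    (ℓ + c) ^ c + (2 * ℓ + 5) ≤ (lam + (2 * c + 4)) ^ (2 * c + 4) := by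
  have hB : (ℓ + c) ^ c ≤ (lam + (2 * c + 4)) ^ (2 * c) := by
    calc (ℓ + c) ^ c ≤ (2 * (lam + c + 3)) ^ c := Nat.pow_le_pow_left (by omega) c
      _ = 2 ^ c * (lam + c + 3) ^ c := by rw [mul_pow]
      _ ≤ (lam + c + 3) ^ c * (lam + c + 3) ^ c :=
          Nat.mul_le_mul_right _ (Nat.pow_le_pow_left (by omega) c)
      _ = (lam + c + 3) ^ (2 * c) := by rw [← pow_add, two_mul]
      _ ≤ (lam + (2 * c + 4)) ^ (2 * c) := Nat.pow_le_pow_left (by omega) _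
  have hD : 4 * lam + 16 ≤ (lam + (2 * c + 4)) ^ 4 := by
    have h64 : 4 ^ 3 ≤ (lam + (2 * c + 4)) ^ 3 := Nat.pow_le_pow_left (by omega) 3
    calc 4 * lam + 16 = (lam + 4) * 4 := by ring
      _ ≤ (lam + (2 * c + 4)) * (lam + (2 * c + 4)) ^ 3 := Nat.mul_le_mul (by omega) (by omega)
      _ = (lam + (2 * c + 4)) ^ 4 := by ring
  have hB1 : 1 ≤ (ℓ + c) ^ c := by
    rcases c with _ | c
    · simp
    · exact Nat.one_le_pow _ _ (by omega)
  calc (ℓ + c) ^ c + (2 * ℓ + 5) ≤ (ℓ + c) ^ c + (ℓ + c) ^ c * (4 * lam + 15) := by nlinarith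
    _ = (ℓ + c) ^ c * (4 * lam + 16) := by ring
    _ ≤ (lam + (2 * c + 4)) ^ (2 * c) * (lam + (2 * c + 4)) ^ 4 := Nat.mul_le_mul hB hD
    _ = (lam + (2 * c + 4)) ^ (2 * c + 4) := by rw [← pow_add]

/-- **K1 ⇐ (A) ∧ (B)** (val-idea-7 g6's `nfp_xc_of_queueGrid`, ported and re-targeted at the route decl).  For `n`
large take `r = ⌊√n⌋/2 - 1`; restrict an EF of `NFP(2n)` to the face and project it onto `PP_r`; compare thresholds.
[folklore assembly; inputs: (A) queue-grid face projection, (B) `PP_r` xc-hardness] -/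
theorem newtXC_of_inputs
    (hF : ∀ r n : ℕ, 1 ≤ r → (r + 1) * (2 * r + 1) ≤ n →
      ∃ (k : ℕ) (cv : Fin k → (Fin (2 * n) × Fin (2 * n) → ℝ)) (δ : Fin k → ℝ)
        (f : (QGV r × QGV r) × Bool × Bool → Fin (2 * n) × Fin (2 * n)),
        (fun x : (Fin (2 * n) × Fin (2 * n)) → ℝ => x ∘ f) ''
            (newt (nestFreeMatchingPoly n ℝ≥0) ∩ {x | ∀ t, cv t ⬝ᵥ x = δ t}) = queueGridPP r)
    (hG : ∀ c : ℕ, ∃ r₀ : ℕ, ∀ r ≥ r₀, ∀ t : ℕ, HasEFOfSize (queueGridPP r) t → 2 ^ ((Nat.log 2 r + c) ^ c) < t) :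
    ∀ c : ℕ, ∃ n₀ : ℕ, ∀ n ≥ n₀, ∀ r : ℕ,
      HasEFOfSize (newt (nestFreeMatchingPoly n ℝ≥0)) r → 2 ^ ((Nat.log 2 n + c) ^ c) < r := by
  classical
  intro c
  obtain ⟨r₀, hr₀⟩ := hG (2 * c + 4)
  refine ⟨(2 * r₀ + 4) ^ 2, fun n hn t hEF => ?_⟩
  -- the grid side `r`
  set q := Nat.sqrt n with hq
  have hq4 : 2 * r₀ + 4 ≤ q := by
    rw [hq, Nat.le_sqrt']
    exact hn
  set r := q / 2 - 1 with hr
  have hr1 : 1 ≤ r := by omega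
  have hr₀r : r₀ ≤ r := by omega
  have hrn : (r + 1) * (2 * r + 1) ≤ n := by
    have h1 : r + 1 ≤ q := by omega
    have h2 : 2 * r + 1 ≤ q := by omega
    have h3 : q * q ≤ n := by rw [hq]; exact Nat.sqrt_le n
    exact (Nat.mul_le_mul h1 h2).trans h3
  -- face + projection
  obtain ⟨k, cv, δ, f, hface⟩ := hF r n hr1 hrn
  have h1 := hEF.inter_eqs cv δ
  have h2 := h1.image_comp (fun x hx => newt_nonneg _ x hx.1) f
  rw [hface, Fintype.card_prod, Fintype.card_fin] at h2
  have h3 := hr₀ r hr₀r _ h2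
  -- logarithms: `log₂ n ≤ 2 log₂ r + 5`
  set ℓ := Nat.log 2 n with hℓ
  set lam := Nat.log 2 r with hlam
  have h16 : 16 ≤ (2 * r₀ + 4) ^ 2 := by nlinarith
  have hn0 : n ≠ 0 := by omega
  have hrlt : r < 2 ^ (lam + 1) := Nat.lt_pow_succ_log_self one_lt_two r
  have hnlt : n < 2 ^ (ℓ + 1) := Nat.lt_pow_succ_log_self one_lt_two n
  have hqr : q ≤ 2 * r + 3 := by omega
  have hn_q : n < (q + 1) * (q + 1) := by
    have := Nat.lt_succ_sqrt n
    rw [← hq] at this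
    simpa [Nat.succ_eq_add_one] using this
  have hX2 : 2 ≤ 2 ^ (lam + 1) := by
    calc (2 : ℕ) = 2 ^ 1 := by norm_num
      _ ≤ 2 ^ (lam + 1) := Nat.pow_le_pow_right (by norm_num) (by omega)
  have hpow : 2 ^ (lam + 3) = 4 * 2 ^ (lam + 1) := by
    rw [show lam + 3 = lam + 1 + 2 by omega, pow_add]; ring
  have hq2 : q + 1 ≤ 2 ^ (lam + 3) := by
    rw [hpow]
    generalize hX : 2 ^ (lam + 1) = X at hrlt hX2
    omega
  have hn2 : n < 2 ^ (2 * lam + 6) := by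
    calc n < (q + 1) * (q + 1) := hn_q
      _ ≤ 2 ^ (lam + 3) * 2 ^ (lam + 3) := Nat.mul_le_mul hq2 hq2
      _ = 2 ^ (2 * lam + 6) := by rw [← pow_add]; ring_nf
  have hℓlam : ℓ ≤ 2 * lam + 5 := by
    have := Nat.log_lt_of_lt_pow hn0 hn2
    omega
  have hroom := grid_threshold_room lam c ℓ hℓlam
  -- `4 n² ≤ 2^(2ℓ+4)`
  have hn4 : 2 * n * (2 * n) ≤ 2 ^ (2 * ℓ + 4) := by
    have hle : n ≤ 2 ^ (ℓ + 1) := hnlt.le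
    calc 2 * n * (2 * n) = 4 * (n * n) := by ring
      _ ≤ 4 * (2 ^ (ℓ + 1) * 2 ^ (ℓ + 1)) := Nat.mul_le_mul_left 4 (Nat.mul_le_mul hle hle)
      _ = 2 ^ (2 * ℓ + 4) := by ring
  -- conclude: 2^B + 4n² ≤ 2^A < 4n² + t
  set A := (lam + (2 * c + 4)) ^ (2 * c + 4) with hA
  set B := (ℓ + c) ^ c with hB
  obtain ⟨A', hA'⟩ : ∃ A', A = A' + 1 := ⟨A - 1, by omega⟩
  have hBA : 2 ^ B ≤ 2 ^ A' := Nat.pow_le_pow_right (by norm_num) (by omega)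
  have hLA : 2 ^ (2 * ℓ + 4) ≤ 2 ^ A' := Nat.pow_le_pow_right (by norm_num) (by omega)
  have h2A : 2 ^ A = 2 ^ A' + 2 ^ A' := by rw [hA', pow_succ]; ring
  have h3' : 2 ^ A < 2 * n * (2 * n) + t := h3
  generalize hM : 2 * n * (2 * n) = M at h3' hn4
  generalize hPB : 2 ^ B = PB at hBA
  generalize hPA : 2 ^ A = PA at h2A h3'
  generalize hPA' : 2 ^ A' = PA' at hBA hLA h2A
  generalize hPL : 2 ^ (2 * ℓ + 4) = PL at hLA hn4
  omega


end Summit.ValiantsHypothesis.ValiantsHypothesis.Theorems.FifoMatching.QueueGridFace
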